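import Literature.Probability.RandomPlanarGeometry.HexSAWBrickWallStripFugacityWidthOneContactWeakLDP
import HarnessLib

/-!
# The full two-dimensional LDP of the contact-density pair inside the density triangle

Child module of `…ContactWeakLDP` (#693).  There the large deviation UPPER bound for the pair `(bc/N, tc/N)` under `P_{N,y,z}` was proved on
compact CONVEX subsets of the open density triangle `T = {a + a' < ½, 4a + 2a' > 1, 2a + 4a' > 1}` (one half-plane Chernoff bound at the
minimiser), and the limit `−inf_G J̃` on bounded open CONVEX sets.  This file removes the convexity:
* §1 the triangle is open; around every point of `T` there is a closed ball inside `T` on which `J̃_{y,z}` drops by less than `δ`;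
* §2 ★★★ UPPER BOUND ON ARBITRARY COMPACT SETS `K ⊆ T`: a minimiser `m ∈ K` of `J̃_{y,z}` exists and
  `P_{N,y,z}((bc/N, tc/N) ∈ K) ≤ e^{−N(J̃(m) − ε)}` eventually (finite cover of `K` by small closed balls — compact and convex — and the
  convex bound of #693 §3 on each ball; the number of balls is absorbed in `e^{Nε/3}`);
* §3 ★★★ THE LIMIT ON EVERY BOUNDED OPEN SET with closure in `T`: `lim (1/N) log P_N(G) = −min_{cl G} J̃ = −inf_G J̃` (`ldp_limit_open`,
  `ldp_limit_open_eq_neg_sInf`) — every such open set is a `J̃`-continuity set because `J̃` is continuous on `T`;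
* §4 ★★ EXPONENTIAL DECAY OFF THE TYPICAL PAIR: if the compact `K ⊆ T` misses `(b(y,z), b(z,y))` then `P_N(K) ≤ e^{−cN}` eventually with an
  explicit `c = J̃(m)/2 > 0` (`J̃ > 0` off the typical pair, `jointRate_pos`).
Together with #693 §2 (lower bound on open sets) this is the large deviation principle for `(bc/N, tc/N)` on the open triangle with the good,
strictly convex rate function `J̃_{y,z}` (unique zero at the typical pair).

## Sources
DemboZeitouni2010 §1.2 (from a weak LDP to the LDP: Lemma 1.2.18 and the covering argument of Theorem 1.2.15's proof pattern; upper bound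
for compact sets from local upper bounds) and §2.2 Theorem 2.2.30 (Cramér in ℝ^d); JansevanRensburg2000 §3.2 (1st ed., OUP 2000; the
one-density case).  Nothing quoted AS PRINTED; statements are this lineage's.
-/

noncomputable section

open Filter Topology Finset Literature.Probability.LatticeModels Literature.Probability.Percolation SimpleGraph

namespace Literature.Probability.RandomPlanarGeometry.SAW.HexBW

open WidthOneYZ

variable {y z : ℝ}

/-! ## §1 The open triangle and local balls -/

/-- The density triangle `T = {a + a' < ½, 4a + 2a' > 1, 2a + 4a' > 1}` is an open subset of `ℝ²`.
[cite: DemboZeitouni2010, §1.2 (lane plumbing)] -/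
theorem isOpen_densityTriangle :
    IsOpen {p : ℝ × ℝ | p.1 + p.2 < 1 / 2 ∧ 1 < 4 * p.1 + 2 * p.2 ∧ 1 < 2 * p.1 + 4 * p.2} := by
  have h1 : IsOpen {p : ℝ × ℝ | p.1 + p.2 < 1 / 2} := isOpen_lt (continuous_fst.add continuous_snd) continuous_const
  have h2 : IsOpen {p : ℝ × ℝ | 1 < 4 * p.1 + 2 * p.2} :=
    isOpen_lt continuous_const ((continuous_const.mul continuous_fst).add (continuous_const.mul continuous_snd))
  have h3 : IsOpen {p : ℝ × ℝ | 1 < 2 * p.1 + 4 * p.2} :=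
    isOpen_lt continuous_const ((continuous_const.mul continuous_fst).add (continuous_const.mul continuous_snd))
  have e : {p : ℝ × ℝ | p.1 + p.2 < 1 / 2 ∧ 1 < 4 * p.1 + 2 * p.2 ∧ 1 < 2 * p.1 + 4 * p.2} =
      {p : ℝ × ℝ | p.1 + p.2 < 1 / 2} ∩ ({p : ℝ × ℝ | 1 < 4 * p.1 + 2 * p.2} ∩ {p : ℝ × ℝ | 1 < 2 * p.1 + 4 * p.2}) := by
    ext p; simp only [Set.mem_setOf_eq, Set.mem_inter_iff]
  rw [e]
  exact h1.inter (h2.inter h3)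

/-- `J̃_{y,z}` is continuous on the open density triangle. [cite: DemboZeitouni2010, §2.2 (lane plumbing)] -/
theorem continuousOn_jointRate_eosY (hy : 0 < y) (hz : 0 < z) :
    ContinuousOn (fun p : ℝ × ℝ => jointRate y z (eosY p.1 p.2) (eosY p.2 p.1))
      {p : ℝ × ℝ | p.1 + p.2 < 1 / 2 ∧ 1 < 4 * p.1 + 2 * p.2 ∧ 1 < 2 * p.1 + 4 * p.2} := by
  intro p hp
  obtain ⟨t1, t2, t3⟩ := hp
  exact (continuousAt_jointRate_eosY hy hz t1 t2 t3).continuousWithinAt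

/-- ★ **Local balls**: around every point `x` of the open triangle and for every `δ > 0` there is a closed ball of positive radius inside
the triangle on which `J̃_{y,z} > J̃_{y,z}(x) − δ` (openness of `T` and continuity of `J̃`).
[cite: DemboZeitouni2010, §1.2 (local form of the upper bound; lane plumbing)] -/
theorem exists_closedBall_jointRate_gt (hy : 0 < y) (hz : 0 < z) {x : ℝ × ℝ}
    (hx : x ∈ {p : ℝ × ℝ | p.1 + p.2 < 1 / 2 ∧ 1 < 4 * p.1 + 2 * p.2 ∧ 1 < 2 * p.1 + 4 * p.2}) {δ : ℝ} (hδ : 0 < δ) :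
    ∃ r : ℝ, 0 < r ∧
      Metric.closedBall x r ⊆ {p : ℝ × ℝ | p.1 + p.2 < 1 / 2 ∧ 1 < 4 * p.1 + 2 * p.2 ∧ 1 < 2 * p.1 + 4 * p.2} ∧
      ∀ p ∈ Metric.closedBall x r,
        jointRate y z (eosY x.1 x.2) (eosY x.2 x.1) - δ < jointRate y z (eosY p.1 p.2) (eosY p.2 p.1) := by
  obtain ⟨t1, t2, t3⟩ := hx
  have hcont := continuousAt_jointRate_eosY hy hz t1 t2 t3
  have hlt : jointRate y z (eosY x.1 x.2) (eosY x.2 x.1) - δ < jointRate y z (eosY x.1 x.2) (eosY x.2 x.1) := by linarith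
  have hev1 : ∀ᶠ p : ℝ × ℝ in 𝓝 x, jointRate y z (eosY x.1 x.2) (eosY x.2 x.1) - δ < jointRate y z (eosY p.1 p.2) (eosY p.2 p.1) :=
    hcont.eventually (lt_mem_nhds hlt)
  have hev2 := isOpen_densityTriangle.mem_nhds (show x ∈ _ from ⟨t1, t2, t3⟩)
  obtain ⟨r, hr0, hr⟩ := Metric.mem_nhds_iff.1 (Filter.inter_mem hev1 hev2)
  have hsub : Metric.closedBall x (r / 2) ⊆ Metric.ball x r := Metric.closedBall_subset_ball (by linarith)
  exact ⟨r / 2, by linarith, fun p hp => (hr (hsub hp)).2, fun p hp => (hr (hsub hp)).1⟩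

/-! ## §2 The upper bound on arbitrary compact sets -/

open Classical in
/-- ★★★ **LDP UPPER BOUND ON COMPACT SETS**: for `y, z > 0` and a nonempty compact `K` inside the open density triangle (no convexity
assumed) there is a minimiser `m ∈ K` of `J̃_{y,z}` on `K`, and for every `ε > 0` eventually
`P_{N,y,z}((bc/N, tc/N) ∈ K) ≤ exp(N·(−J̃_{y,z}(m) + ε))`, i.e. `limsup (1/N) log P_N(K) ≤ −min_K J̃`.
Proof: cover `K` by finitely many closed balls inside `T`, each so small that `J̃ > J̃(centre) − ε/3 ≥ J̃(m) − ε/3` on it; each ball is compact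
and convex, so #693 §3 bounds its probability by `exp(N(−J̃(m) + 2ε/3))`; the number of balls is eventually `≤ exp(Nε/3)`.
[cite: DemboZeitouni2010, §1.2 (upper bound for compact sets from local bounds, the covering step) and §2.2 Theorem 2.2.30; JansevanRensburg2000, §3.2 Theorems 3.17–3.19 (1st ed., pp. 50–52)] -/
theorem ldp_upper_compact (hy : 0 < y) (hz : 0 < z) {K : Set (ℝ × ℝ)} (hK : IsCompact K) (hne : K.Nonempty)
    (hKT : K ⊆ {p : ℝ × ℝ | p.1 + p.2 < 1 / 2 ∧ 1 < 4 * p.1 + 2 * p.2 ∧ 1 < 2 * p.1 + 4 * p.2}) :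
    ∃ m ∈ K, IsMinOn (fun p : ℝ × ℝ => jointRate y z (eosY p.1 p.2) (eosY p.2 p.1)) K m ∧
      ∀ {ε : ℝ}, 0 < ε → ∀ᶠ N : ℕ in atTop,
        (∑ q ∈ (stripPairs 1 N).filter (fun q =>
          (((bottomVisits₀ q.1 q.2 N : ℝ) / N, (topVisits₀ 1 q.1 q.2 N : ℝ) / N) : ℝ × ℝ) ∈ K), wgt y z N q) / stripZ₂ 1 N y z ≤
        Real.exp ((-(jointRate y z (eosY m.1 m.2) (eosY m.2 m.1)) + ε) * N) := by
  set J : ℝ × ℝ → ℝ := fun p => jointRate y z (eosY p.1 p.2) (eosY p.2 p.1) with hJdef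
  obtain ⟨m, hm, hmin⟩ := hK.exists_isMinOn hne ((continuousOn_jointRate_eosY hy hz).mono hKT)
  refine ⟨m, hm, hmin, fun {ε} hε => ?_⟩
  have hε3 : 0 < ε / 3 := by linarith
  -- radii of the covering balls
  have hrad : ∀ x : ℝ × ℝ, ∃ r : ℝ, 0 < r ∧ (x ∈ K →
      (Metric.closedBall x r ⊆ {p : ℝ × ℝ | p.1 + p.2 < 1 / 2 ∧ 1 < 4 * p.1 + 2 * p.2 ∧ 1 < 2 * p.1 + 4 * p.2} ∧
        ∀ p ∈ Metric.closedBall x r, J x - ε / 3 < J p)) := by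
    intro x
    by_cases hx : x ∈ K
    · obtain ⟨r, hr0, h1, h2⟩ := exists_closedBall_jointRate_gt hy hz (hKT hx) hε3
      exact ⟨r, hr0, fun _ => ⟨h1, h2⟩⟩
    · exact ⟨1, one_pos, fun h => absurd h hx⟩
  choose r hr0 hrK using hrad
  obtain ⟨t, htK, hcover⟩ :=
    hK.elim_nhds_subcover (fun x => Metric.ball x (r x)) (fun x _ => Metric.ball_mem_nhds x (hr0 x))
  -- the bound on each ball of the cover
  have hball : ∀ x ∈ t, ∀ᶠ N : ℕ in atTop,
      (∑ q ∈ (stripPairs 1 N).filter (fun q =>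
        (((bottomVisits₀ q.1 q.2 N : ℝ) / N, (topVisits₀ 1 q.1 q.2 N : ℝ) / N) : ℝ × ℝ) ∈ Metric.closedBall x (r x)), wgt y z N q) /
        stripZ₂ 1 N y z ≤ Real.exp ((-(J m) + 2 * ε / 3) * N) := by
    intro x hx
    have hxK : x ∈ K := htK x hx
    obtain ⟨hBT, hBJ⟩ := hrK x hxK
    obtain ⟨m', hm', -, hup⟩ := ldp_upper_compact_convex hy hz (isCompact_closedBall x (r x)) (convex_closedBall x (r x))
      ⟨x, Metric.mem_closedBall_self (hr0 x).le⟩ hBT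
    have h1 : J x - ε / 3 < J m' := hBJ m' hm'
    have h2 : J m ≤ J x := (isMinOn_iff.1 hmin) x hxK
    filter_upwards [hup hε3] with N hN
    refine hN.trans (Real.exp_le_exp.2 (mul_le_mul_of_nonneg_right ?_ (Nat.cast_nonneg N)))
    show -(J m') + ε / 3 ≤ -(J m) + 2 * ε / 3
    linarith
  -- the number of balls is eventually `≤ exp(N ε/3)`
  have hcard : ∀ᶠ N : ℕ in atTop, (t.card : ℝ) ≤ Real.exp (ε / 3 * N) := by
    have h : Tendsto (fun N : ℕ => Real.exp (ε / 3 * (N : ℝ))) atTop atTop :=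
      Real.tendsto_exp_atTop.comp (tendsto_natCast_atTop_atTop.const_mul_atTop hε3)
    exact h.eventually_ge_atTop _
  filter_upwards [(Finset.eventually_all t).2 hball, hcard] with N hN hc
  -- numerator: every pair in `K` lies in one of the balls
  have hnum : (∑ q ∈ (stripPairs 1 N).filter (fun q =>
      (((bottomVisits₀ q.1 q.2 N : ℝ) / N, (topVisits₀ 1 q.1 q.2 N : ℝ) / N) : ℝ × ℝ) ∈ K), wgt y z N q) ≤
      ∑ x ∈ t, ∑ q ∈ (stripPairs 1 N).filter (fun q =>
        (((bottomVisits₀ q.1 q.2 N : ℝ) / N, (topVisits₀ 1 q.1 q.2 N : ℝ) / N) : ℝ × ℝ) ∈ Metric.closedBall x (r x)), wgt y z N q := by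
    rw [Finset.sum_filter]
    simp_rw [Finset.sum_filter]
    rw [Finset.sum_comm]
    refine Finset.sum_le_sum fun q _ => ?_
    have hnn : ∀ x' ∈ t, (0 : ℝ) ≤ (if (((bottomVisits₀ q.1 q.2 N : ℝ) / N, (topVisits₀ 1 q.1 q.2 N : ℝ) / N) : ℝ × ℝ) ∈
        Metric.closedBall x' (r x') then wgt y z N q else 0) := by
      intro x' _
      split_ifs
      · exact wgt_nonneg hy.le hz.le N q
      · exact le_rfl
    split_ifs with hqK
    · obtain ⟨x, hxt, hxball⟩ := Set.mem_iUnion₂.1 (hcover hqK)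
      have hxcl : (((bottomVisits₀ q.1 q.2 N : ℝ) / N, (topVisits₀ 1 q.1 q.2 N : ℝ) / N) : ℝ × ℝ) ∈ Metric.closedBall x (r x) :=
        Metric.ball_subset_closedBall hxball
      have hs := Finset.single_le_sum hnn hxt
      rw [if_pos hxcl] at hs
      exact hs
    · exact Finset.sum_nonneg hnn
  have hZ := stripZ₂_pos 1 N hy hz
  calc (∑ q ∈ (stripPairs 1 N).filter (fun q =>
          (((bottomVisits₀ q.1 q.2 N : ℝ) / N, (topVisits₀ 1 q.1 q.2 N : ℝ) / N) : ℝ × ℝ) ∈ K), wgt y z N q) / stripZ₂ 1 N y z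
      ≤ (∑ x ∈ t, ∑ q ∈ (stripPairs 1 N).filter (fun q =>
          (((bottomVisits₀ q.1 q.2 N : ℝ) / N, (topVisits₀ 1 q.1 q.2 N : ℝ) / N) : ℝ × ℝ) ∈ Metric.closedBall x (r x)), wgt y z N q) /
          stripZ₂ 1 N y z := div_le_div_of_nonneg_right hnum hZ.le
    _ = ∑ x ∈ t, (∑ q ∈ (stripPairs 1 N).filter (fun q =>
          (((bottomVisits₀ q.1 q.2 N : ℝ) / N, (topVisits₀ 1 q.1 q.2 N : ℝ) / N) : ℝ × ℝ) ∈ Metric.closedBall x (r x)), wgt y z N q) /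
          stripZ₂ 1 N y z := Finset.sum_div _ _ _
    _ ≤ ∑ x ∈ t, Real.exp ((-(J m) + 2 * ε / 3) * N) := Finset.sum_le_sum fun x hx => hN x hx
    _ = (t.card : ℝ) * Real.exp ((-(J m) + 2 * ε / 3) * N) := by rw [Finset.sum_const, nsmul_eq_mul]
    _ ≤ Real.exp (ε / 3 * N) * Real.exp ((-(J m) + 2 * ε / 3) * N) :=
        mul_le_mul_of_nonneg_right hc (Real.exp_pos _).le
    _ = Real.exp ((-(J m) + ε) * N) := by rw [← Real.exp_add]; ring_nf

/-! ## §3 The large deviation limit on bounded open sets -/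

open Classical in
/-- ★★★ **THE LARGE DEVIATION LIMIT ON BOUNDED OPEN SETS**: for `y, z > 0` and a nonempty bounded open `G` (no convexity) whose closure
lies in the open density triangle there is a minimiser `m ∈ closure G` of `J̃_{y,z}` with
`lim_{N→∞} (1/N) log P_{N,y,z}((bc/N, tc/N) ∈ G) = −J̃_{y,z}(m)` — upper bound on the compact closure (§2), lower bound at points of `G`
near `m` (#693 §2 and the continuity of `J̃`): every such `G` is a `J̃`-continuity set.
[cite: DemboZeitouni2010, §1.2 (the LDP and continuity sets) and §2.2 Theorem 2.2.30; JansevanRensburg2000, §3.2 Theorems 3.17–3.19 (1st ed., pp. 50–52)] -/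
theorem ldp_limit_open (hy : 0 < y) (hz : 0 < z) {G : Set (ℝ × ℝ)} (hGo : IsOpen G) (hne : G.Nonempty)
    (hbd : Bornology.IsBounded G)
    (hGT : closure G ⊆ {p : ℝ × ℝ | p.1 + p.2 < 1 / 2 ∧ 1 < 4 * p.1 + 2 * p.2 ∧ 1 < 2 * p.1 + 4 * p.2}) :
    ∃ m ∈ closure G, IsMinOn (fun p : ℝ × ℝ => jointRate y z (eosY p.1 p.2) (eosY p.2 p.1)) (closure G) m ∧
      Tendsto (fun N : ℕ => Real.log ((∑ q ∈ (stripPairs 1 N).filter (fun q =>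
          (((bottomVisits₀ q.1 q.2 N : ℝ) / N, (topVisits₀ 1 q.1 q.2 N : ℝ) / N) : ℝ × ℝ) ∈ G), wgt y z N q) / stripZ₂ 1 N y z) / N)
        atTop (𝓝 (-(jointRate y z (eosY m.1 m.2) (eosY m.2 m.1)))) := by
  have hK : IsCompact (closure G) := hbd.isCompact_closure
  have hKne : (closure G).Nonempty := hne.mono subset_closure
  obtain ⟨m, hm, hmin, hup⟩ := ldp_upper_compact hy hz hK hKne hGT
  refine ⟨m, hm, hmin, ?_⟩
  obtain ⟨t1, t2, t3⟩ := hGT hm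
  set J := jointRate y z (eosY m.1 m.2) (eosY m.2 m.1) with hJ
  refine tendsto_log_div_of_exp_bounds (fun ε hε => ?_) (fun ε hε => ?_)
  · -- lower bound: a point of `G` near `m` with `J̃ < J̃(m) + ε/2`
    have hε2 : 0 < ε / 2 := by linarith
    have hcont := continuousAt_jointRate_eosY hy hz t1 t2 t3
    have hlt : (fun p : ℝ × ℝ => jointRate y z (eosY p.1 p.2) (eosY p.2 p.1)) m < J + ε / 2 := by
      simp only [hJ]; linarith
    have hev := hcont.eventually (gt_mem_nhds hlt)
    obtain ⟨U, hU, hUo, hmU⟩ := mem_nhds_iff.1 hev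
    obtain ⟨p, hpU, hpG⟩ : (U ∩ G).Nonempty := mem_closure_iff.1 hm U hUo hmU
    have hpJ : jointRate y z (eosY p.1 p.2) (eosY p.2 p.1) < J + ε / 2 := hU hpU
    obtain ⟨s1, s2, s3⟩ := hGT (subset_closure hpG)
    have hpG' : (p.1, p.2) ∈ G := hpG
    filter_upwards [ldp_lower_open hy hz hGo hpG' s1 s2 s3 hε2] with N hN
    refine le_trans (Real.exp_le_exp.2 (mul_le_mul_of_nonneg_right ?_ (Nat.cast_nonneg N))) hN
    linarith
  · -- upper bound: `G ⊆ closure G`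
    filter_upwards [hup hε] with N hN
    refine le_trans ?_ hN
    refine div_le_div_of_nonneg_right ?_ (stripZ₂_pos 1 N hy hz).le
    refine Finset.sum_le_sum_of_subset_of_nonneg (fun q hq => ?_) fun q _ _ => wgt_nonneg hy.le hz.le N q
    rw [Finset.mem_filter] at hq ⊢
    exact ⟨hq.1, subset_closure hq.2⟩

/-- ★ The minimum over the closure is the infimum over the open set: if `m ∈ closure G` minimises `J̃_{y,z}` on `closure G ⊆ T`, then
`J̃_{y,z}(m)` is the greatest lower bound of `J̃_{y,z}` on `G` (continuity of `J̃` at `m`).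
[cite: DemboZeitouni2010, §1.2 (continuity sets; lane plumbing)] -/
theorem isGLB_jointRate_eosY_image (hy : 0 < y) (hz : 0 < z) {G : Set (ℝ × ℝ)}
    (hGT : closure G ⊆ {p : ℝ × ℝ | p.1 + p.2 < 1 / 2 ∧ 1 < 4 * p.1 + 2 * p.2 ∧ 1 < 2 * p.1 + 4 * p.2}) {m : ℝ × ℝ}
    (hm : m ∈ closure G) (hmin : IsMinOn (fun p : ℝ × ℝ => jointRate y z (eosY p.1 p.2) (eosY p.2 p.1)) (closure G) m) :
    IsGLB ((fun p : ℝ × ℝ => jointRate y z (eosY p.1 p.2) (eosY p.2 p.1)) '' G) (jointRate y z (eosY m.1 m.2) (eosY m.2 m.1)) := by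
  refine ⟨?_, fun b hb => ?_⟩
  · rintro _ ⟨p, hp, rfl⟩
    exact (isMinOn_iff.1 hmin) p (subset_closure hp)
  · by_contra hlt
    push Not at hlt
    obtain ⟨t1, t2, t3⟩ := hGT hm
    have hcont := continuousAt_jointRate_eosY hy hz t1 t2 t3
    have hlt' : (fun p : ℝ × ℝ => jointRate y z (eosY p.1 p.2) (eosY p.2 p.1)) m < b := hlt
    have hev := hcont.eventually (gt_mem_nhds hlt')
    obtain ⟨U, hU, hUo, hmU⟩ := mem_nhds_iff.1 hev
    obtain ⟨p, hpU, hpG⟩ : (U ∩ G).Nonempty := mem_closure_iff.1 hm U hUo hmU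
    have h1 : jointRate y z (eosY p.1 p.2) (eosY p.2 p.1) < b := hU hpU
    have h2 : b ≤ jointRate y z (eosY p.1 p.2) (eosY p.2 p.1) := hb ⟨p, hpG, rfl⟩
    linarith

open Classical in
/-- ★★★ **THE LDP LIMIT AS AN INFIMUM**: for `y, z > 0` and a nonempty bounded open `G` with closure in the open density triangle,
`lim_{N→∞} (1/N) log P_{N,y,z}((bc/N, tc/N) ∈ G) = −inf_{G} J̃_{y,z}`.
[cite: DemboZeitouni2010, §1.2 (the large deviation principle: −inf over open sets = −inf over their closures for continuity sets) and §2.2 Theorem 2.2.30] -/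
theorem ldp_limit_open_eq_neg_sInf (hy : 0 < y) (hz : 0 < z) {G : Set (ℝ × ℝ)} (hGo : IsOpen G) (hne : G.Nonempty)
    (hbd : Bornology.IsBounded G)
    (hGT : closure G ⊆ {p : ℝ × ℝ | p.1 + p.2 < 1 / 2 ∧ 1 < 4 * p.1 + 2 * p.2 ∧ 1 < 2 * p.1 + 4 * p.2}) :
    Tendsto (fun N : ℕ => Real.log ((∑ q ∈ (stripPairs 1 N).filter (fun q =>
        (((bottomVisits₀ q.1 q.2 N : ℝ) / N, (topVisits₀ 1 q.1 q.2 N : ℝ) / N) : ℝ × ℝ) ∈ G), wgt y z N q) / stripZ₂ 1 N y z) / N)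
      atTop (𝓝 (-(sInf ((fun p : ℝ × ℝ => jointRate y z (eosY p.1 p.2) (eosY p.2 p.1)) '' G)))) := by
  obtain ⟨m, hm, hmin, hlim⟩ := ldp_limit_open hy hz hGo hne hbd hGT
  have hglb := isGLB_jointRate_eosY_image hy hz hGT hm hmin
  rw [hglb.csInf_eq (hne.image _)]
  exact hlim

/-! ## §4 Exponential decay off the typical pair -/

/-- ★ Off the typical pair the rate is positive: for `p = (a,a')` in the open triangle with `p ≠ (b(y,z), b(z,y))`, `J̃_{y,z}(p) > 0`
(the tilt `(Y(a,a'), Y(a',a))` differs from `(y,z)` by the equation of state, and `jointRate_pos`).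
[cite: DemboZeitouni2010, §2.2 (good rate function with a unique zero; lane statement)] -/
theorem jointRate_eosY_pos_of_ne (hy : 0 < y) (hz : 0 < z) {a a' : ℝ} (h1 : a + a' < 1 / 2) (h2 : 1 < 4 * a + 2 * a')
    (h3 : 1 < 2 * a + 4 * a') (hne : (a, a') ≠ (contactB y z, contactB z y)) :
    0 < jointRate y z (eosY a a') (eosY a' a) := by
  obtain ⟨hY0, hZ0, hb, hb', -, -⟩ := contactB_eosY h1 h2 h3
  refine jointRate_pos hy hz hY0 hZ0 ?_
  by_contra hc
  push Not at hc
  obtain ⟨e1, e2⟩ := hc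
  apply hne
  rw [← e1, ← e2] at hb hb'
  rw [hb, hb']

open Classical in
/-- ★★ **EXPONENTIAL DECAY OFF THE TYPICAL PAIR**: for `y, z > 0` and a compact `K` inside the open density triangle NOT containing the
typical pair `(b(y,z), b(z,y))`, there is `c > 0` (namely half the minimum of `J̃_{y,z}` over `K`) with
`P_{N,y,z}((bc/N, tc/N) ∈ K) ≤ exp(−cN)` eventually.
[cite: DemboZeitouni2010, §1.2 and §2.2 Theorem 2.2.30 (upper bound + unique zero of the rate); JansevanRensburg2000, §3.2 (1st ed., pp. 50–52)] -/
theorem eventually_fraction_compact_le_exp_neg (hy : 0 < y) (hz : 0 < z) {K : Set (ℝ × ℝ)} (hK : IsCompact K)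
    (hKT : K ⊆ {p : ℝ × ℝ | p.1 + p.2 < 1 / 2 ∧ 1 < 4 * p.1 + 2 * p.2 ∧ 1 < 2 * p.1 + 4 * p.2})
    (hmiss : ((contactB y z, contactB z y) : ℝ × ℝ) ∉ K) :
    ∃ c : ℝ, 0 < c ∧ ∀ᶠ N : ℕ in atTop,
      (∑ q ∈ (stripPairs 1 N).filter (fun q =>
        (((bottomVisits₀ q.1 q.2 N : ℝ) / N, (topVisits₀ 1 q.1 q.2 N : ℝ) / N) : ℝ × ℝ) ∈ K), wgt y z N q) / stripZ₂ 1 N y z ≤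
        Real.exp (-(c * N)) := by
  by_cases hne : K.Nonempty
  · obtain ⟨m, hm, -, hup⟩ := ldp_upper_compact hy hz hK hne hKT
    obtain ⟨t1, t2, t3⟩ := hKT hm
    have hmne : ((m.1, m.2) : ℝ × ℝ) ≠ (contactB y z, contactB z y) := by
      intro h; exact hmiss (by rw [← h]; exact hm)
    have hpos := jointRate_eosY_pos_of_ne hy hz t1 t2 t3 hmne
    refine ⟨jointRate y z (eosY m.1 m.2) (eosY m.2 m.1) / 2, by linarith, ?_⟩
    filter_upwards [hup (show 0 < jointRate y z (eosY m.1 m.2) (eosY m.2 m.1) / 2 by linarith)] with N hN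
    refine hN.trans (le_of_eq ?_)
    congr 1; ring
  · refine ⟨1, one_pos, Filter.Eventually.of_forall fun N => ?_⟩
    have hempty : (stripPairs 1 N).filter (fun q =>
        (((bottomVisits₀ q.1 q.2 N : ℝ) / N, (topVisits₀ 1 q.1 q.2 N : ℝ) / N) : ℝ × ℝ) ∈ K) = ∅ := by
      refine Finset.filter_eq_empty_iff.2 fun q _ hq => hne ⟨_, hq⟩
    rw [hempty, Finset.sum_empty, zero_div]
    exact (Real.exp_pos _).le

end Literature.Probability.RandomPlanarGeometry.SAW.HexBW
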